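import Mathlib
import Literature.Analysis.SpecialFunctions.IsStieltjesFunction
import Summits.CriticalPhenomena.Ising3DConformalLimit.Theorems.GSMRigidity.Negative.ThreeAtomKernel

/-!
# `GSMRigidity` (item stmt-CriticalPhenomena-8366), line `momentum-one-amplitude`: two stub hypotheses
# certified NECESSARY — `0 < Δ` in S1 `stub_mixingMeasureStructure`, `1 ≤ β` in S4 `stub_stieltjesHalfPlane`

Negative-lane tightness lemmas (refuter, drefute seat `refuter-drefute-stmt-CriticalPhenomena-8366-0`) for
the registered skeleton `Cruxes/GSMRigidity/Lines/momentum-one-amplitude.lean` of the crux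
`Summit.CriticalPhenomena.Ising3DConformalLimit.Theses.GaussianScaleMixture.GSMRigidity`.
No stub of that line is false; these two lemmas record that two of its hypotheses cannot be weakened.

* `stub_mixingMeasureStructure_false_without_pos` — S1 ("the mixing measure of a `Δ`-homogeneous,
  nine-mirror-invariant Gaussian scale mixture may be taken on the OPEN octant, σ-finite, exchangeable
  and `Δ`-homogeneous") with `0 < Δ` weakened to `0 ≤ Δ` is FALSE.  Witness `Δ = 0`: the constant kernel
  `K ≡ 1` is homogeneous of degree `0`, invariant under every mirror, and a Gaussian scale mixture off the
  origin with mixing measure `δ₀` (carried by the CLOSED octant, where the stub's hypothesis lives); but no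
  measure carried by the open octant represents a non-zero constant: along `x_c = c(1,1,1)` the integrand
  `exp(-c² Σ sᵢ)` tends to `0` on the open octant, dominated by its value at `c = 1`, so `K(x_c) → 0`
  (dominated convergence) while `K ≡ 1`.  (For `Δ > 0` the origin is a dilation-invariant set of finite,
  hence zero, `ν`-mass — the step of the stub's proof sketch that fails at `Δ = 0`.)
* `stub_stieltjesHalfPlane_false_without_one_le` — S4 ("a Stieltjes `g` with `g(r²) ≤ M₀ r^{-β}`,
  `β ≥ 1`, continues to `F = g(t²)` holomorphic on `{Re t > 0}` with `‖F t‖ ≤ M₀ (Re t)^{-β}`") with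
  `1 ≤ β` weakened to `0 < β` is FALSE.  Witness: the resolvent `g s = (s + 1)⁻¹` (Stieltjes, measure
  `δ₁`), `β = 1/2`, `M₀ = 1` (`(r² + 1)⁻¹ ≤ r^{-1/2}`); the continuation is `(t² + 1)⁻¹` (identity
  theorem from `(0,∞)`), and at `t₀ = 1/16 + i`, `‖t₀² + 1‖ = ‖1/256 + i/8‖ < 1/4`, so
  `‖F t₀‖ > 4 = M₀ (Re t₀)^{-1/2}`.  The pole `t = i` of `g(t²)` sits ON the boundary of the half-plane;
  the stub's chain `‖F‖ ≤ (|t|/Re t) g(|t|²) ≤ M₀ |t|^{1-β}/Re t` closes to `M₀ (Re t)^{-β}` exactly when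
  `1 - β ≤ 0`; in the line `β = 3 - 2Δ`, so this is where `Δ ≤ 1` enters.  (Same witness family as the
  standing disprover's `stieltjesHalfPlane_false_at_beta_half`, Disproof F11/F14, found independently;
  different test point.)

No definitions (the witness data live inside the proofs). [folklore]
-/

noncomputable section

open MeasureTheory Filter Topology Complex Literature.Analysis.SpecialFunctions
open scoped BigOperators

namespace Summit.CriticalPhenomena.Ising3DConformalLimit.Theorems.GSMRigidity.Negative

/-! ## S1: `0 < Δ` is necessary -/


/-- The set of points with a negative coordinate does not contain the origin, so `δ₀` gives it mass `0`.
[folklore] -/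
theorem dirac_zero_negSet : (Measure.dirac (0 : Fin 3 → ℝ)) {s | ∃ i, s i < 0} = 0 := by
  rw [← nonpos_iff_eq_zero]
  calc (Measure.dirac (0 : Fin 3 → ℝ)) {s | ∃ i, s i < 0}
      ≤ (Measure.dirac (0 : Fin 3 → ℝ)) {(0 : Fin 3 → ℝ)}ᶜ := by
        refine measure_mono fun s ⟨i, hi⟩ hs0 => ?_
        rw [Set.mem_singleton_iff] at hs0
        rw [hs0] at hi
        simp at hi
    _ = 0 := by
        rw [Measure.dirac_apply' _ (MeasurableSet.compl (measurableSet_singleton _))]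
        simp

/-- Coordinates of `c • (1,1,1)`. [folklore] -/
theorem smul_v111_apply (c : ℝ) (i : Fin 3) : (c • v111) i = c := by
  rw [PiLp.smul_apply, smul_eq_mul, v111_apply, mul_one]

/-- `c • (1,1,1) ≠ 0` for `c ≠ 0`. [folklore] -/
theorem smul_v111_ne_zero {c : ℝ} (hc : c ≠ 0) : c • v111 ≠ (0 : E3) := by
  intro h
  have := congrArg (fun v : E3 => v 0) h
  simp only [smul_v111_apply, PiLp.zero_apply] at this
  exact hc this

/-- The Gaussian-scale-mixture integrand at `x = c • (1,1,1)` is `exp (-(c² Σ sᵢ))`. [folklore] -/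
theorem gsmIntegrand_smul_v111 (c : ℝ) (s : Fin 3 → ℝ) :
    Real.exp (-∑ i, s i * ((c • v111) i) ^ 2) = Real.exp (-(c ^ 2 * ∑ i, s i)) := by
  congr 1
  simp only [smul_v111_apply, Finset.mul_sum]
  congr 1
  refine Finset.sum_congr rfl fun i _ => ?_
  ring

/-- **`0 < Δ` is load-bearing in `stub_mixingMeasureStructure` (S1 of line `momentum-one-amplitude`).**
With `0 < Δ` weakened to `0 ≤ Δ` the stub is false: witness `Δ = 0`, `K ≡ 1`, `ν = δ₀`. [folklore] -/
theorem stub_mixingMeasureStructure_false_without_pos :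
    ¬ ∀ (Δ : ℝ) (K : E3 → ℝ), 0 ≤ Δ →
      (∀ c : ℝ, 0 < c → ∀ x, K (c • x) = c ^ (-(2 * Δ)) * K x) →
      (∀ n : E3, (∃ i j : Fin 3, i ≠ j ∧ (n = EuclideanSpace.single i 1 ∨
          n = EuclideanSpace.single i 1 + EuclideanSpace.single j 1 ∨
          n = EuclideanSpace.single i 1 - EuclideanSpace.single j 1)) →
        ∀ x, K (((ℝ ∙ n)ᗮ).reflection x) = K x) →
      (∃ ν : Measure (Fin 3 → ℝ), ν {s | ∃ i, s i < 0} = 0 ∧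
        ∀ x, x ≠ 0 → Integrable (fun s => Real.exp (-∑ i, s i * (x i) ^ 2)) ν ∧
          K x = ∫ s, Real.exp (-∑ i, s i * (x i) ^ 2) ∂ν) →
      ∃ ν : Measure (Fin 3 → ℝ), ν {s | ∃ i, s i ≤ 0} = 0 ∧ SigmaFinite ν ∧
        (∀ σ : Equiv.Perm (Fin 3), ν.map (fun s : Fin 3 → ℝ => s ∘ σ) = ν) ∧
        (∀ c : ℝ, 0 < c → ν.map (fun s : Fin 3 → ℝ => c • s) = ENNReal.ofReal (c ^ (-Δ)) • ν) ∧
        (∀ x, x ≠ 0 → Integrable (fun s => Real.exp (-∑ i, s i * (x i) ^ 2)) ν ∧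
          K x = ∫ s, Real.exp (-∑ i, s i * (x i) ^ 2) ∂ν) := by
  intro h
  -- the witness: `Δ = 0`, `K ≡ 1`, `ν = δ₀`
  have hgsm : ∃ ν : Measure (Fin 3 → ℝ), ν {s | ∃ i, s i < 0} = 0 ∧
      ∀ x : E3, x ≠ 0 → Integrable (fun s => Real.exp (-∑ i, s i * (x i) ^ 2)) ν ∧
        (1 : ℝ) = ∫ s, Real.exp (-∑ i, s i * (x i) ^ 2) ∂ν := by
    refine ⟨Measure.dirac 0, dirac_zero_negSet, fun x _ => ⟨?_, ?_⟩⟩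
    · exact (integrable_const (Real.exp (-∑ i, (0 : Fin 3 → ℝ) i * (x i) ^ 2))).congr
        (ae_eq_dirac fun s : Fin 3 → ℝ => Real.exp (-∑ i, s i * (x i) ^ 2)).symm
    · rw [integral_dirac]
      simp
  obtain ⟨ν, hν0, -, -, -, hrep⟩ := h 0 (fun _ => (1 : ℝ)) le_rfl
    (fun c hc x => by simp) (fun n _ x => rfl) hgsm
  -- `ν` is carried by the open octant: a.e. every coordinate is positive
  have hae : ∀ᵐ s ∂ν, ∀ i, 0 < s i := by
    have h1 : ∀ᵐ s ∂ν, s ∉ {s : Fin 3 → ℝ | ∃ i, s i ≤ 0} := measure_eq_zero_iff_ae_notMem.1 hν0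
    filter_upwards [h1] with s hs i
    by_contra hcon
    exact hs ⟨i, not_lt.1 hcon⟩
  -- the test points `x_n = (n+1) • (1,1,1)`
  set cn : ℕ → ℝ := fun n => ((n + 1 : ℕ) : ℝ) with hcn
  have hcn_pos : ∀ n, 0 < cn n := fun n => by simp only [hcn]; positivity
  have hcn_one : ∀ n, 1 ≤ cn n := fun n => by
    simp only [hcn]; exact_mod_cast Nat.succ_le_succ (Nat.zero_le n)
  set F : ℕ → (Fin 3 → ℝ) → ℝ := fun n s => Real.exp (-∑ i, s i * ((cn n • v111) i) ^ 2) with hF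
  have hFint : ∀ n, Integrable (F n) ν := fun n => (hrep _ (smul_v111_ne_zero (hcn_pos n).ne')).1
  have hFone : ∀ n, ∫ s, F n s ∂ν = 1 := fun n => (hrep _ (smul_v111_ne_zero (hcn_pos n).ne')).2.symm
  have hF' : ∀ n s, F n s = Real.exp (-(cn n ^ 2 * ∑ i, s i)) := fun n s => gsmIntegrand_smul_v111 _ _
  -- dominated convergence: `∫ F n dν → 0`
  have hlim : Tendsto (fun n => ∫ s, F n s ∂ν) atTop (𝓝 (∫ _s, (0 : ℝ) ∂ν)) := by
    refine tendsto_integral_of_dominated_convergence (fun s => F 0 s)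
      (fun n => (hFint n).aestronglyMeasurable) (hFint 0) (fun n => ?_) ?_
    · filter_upwards [hae] with s hs
      have hsum : 0 ≤ ∑ i, s i := Finset.sum_nonneg fun i _ => (hs i).le
      show ‖F n s‖ ≤ F 0 s
      rw [Real.norm_eq_abs, hF' n s, hF' 0 s, abs_of_pos (Real.exp_pos _)]
      refine Real.exp_le_exp.2 (neg_le_neg ?_)
      have h0 : cn 0 = 1 := by simp [hcn]
      rw [h0, one_pow, one_mul]
      have h1 := hcn_one n
      have hsq : (1 : ℝ) ≤ cn n ^ 2 := by nlinarith
      calc ∑ i, s i = 1 * ∑ i, s i := (one_mul _).symm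
        _ ≤ cn n ^ 2 * ∑ i, s i := mul_le_mul_of_nonneg_right hsq hsum
    · filter_upwards [hae] with s hs
      have hsum : 0 < ∑ i, s i :=
        Finset.sum_pos (fun i _ => hs i) Finset.univ_nonempty
      have h1 : Tendsto cn atTop atTop := by
        simp only [hcn]
        exact tendsto_natCast_atTop_atTop.comp (tendsto_add_atTop_nat 1)
      have h2 : Tendsto (fun n => cn n ^ 2 * ∑ i, s i) atTop atTop :=
        ((tendsto_pow_atTop two_ne_zero).comp h1).atTop_mul_const hsum
      have h3 : Tendsto (fun n => Real.exp (-(cn n ^ 2 * ∑ i, s i))) atTop (𝓝 0) :=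
        Real.tendsto_exp_atBot.comp (tendsto_neg_atTop_atBot.comp h2)
      refine h3.congr fun n => ?_
      exact (hF' n s).symm
  simp only [integral_zero] at hlim
  have hconst : Tendsto (fun _ : ℕ => (1 : ℝ)) atTop (𝓝 0) :=
    hlim.congr fun n => hFone n
  exact zero_ne_one (tendsto_nhds_unique hconst tendsto_const_nhds)


/-! ## S4: `1 ≤ β` is necessary -/


/-- `t² + 1 ≠ 0` on the open right half-plane. [folklore] -/
theorem sq_add_one_ne_zero_of_re_pos {t : ℂ} (ht : 0 < t.re) : t ^ 2 + 1 ≠ 0 := by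
  intro h
  have him : 2 * t.re * t.im = 0 := by
    have := congrArg Complex.im h
    simp [sq, Complex.mul_im] at this
    linarith
  have hre : t.re * t.re - t.im * t.im + 1 = 0 := by
    have := congrArg Complex.re h
    simpa [sq, Complex.mul_re] using this
  have htim : t.im = 0 := by
    rcases mul_eq_zero.1 him with h2 | h2
    · rcases mul_eq_zero.1 h2 with h3 | h3
      · norm_num at h3
      · linarith
    · exact h2
  rw [htim] at hre
  nlinarith

/-- The resolvent bound used by the witness: `(r² + 1)⁻¹ ≤ r^{-1/2}` for `r > 0`. [folklore] -/
theorem inv_sq_add_one_le_rpow_neg_half {r : ℝ} (hr : 0 < r) :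
    (r ^ 2 + 1)⁻¹ ≤ 1 * r ^ (-(1 / 2 : ℝ)) := by
  rw [one_mul, Real.rpow_neg hr.le, ← Real.sqrt_eq_rpow]
  have hsqrt : Real.sqrt r ≤ r ^ 2 + 1 := by
    have h1 : Real.sqrt r ≤ (r + 1) / 2 := by
      have h2 : r ≤ ((r + 1) / 2) ^ 2 := by nlinarith [sq_nonneg (r - 1)]
      calc Real.sqrt r ≤ Real.sqrt (((r + 1) / 2) ^ 2) := Real.sqrt_le_sqrt h2
        _ = (r + 1) / 2 := Real.sqrt_sq (by positivity)
    nlinarith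
  exact inv_anti₀ (Real.sqrt_pos.2 hr) hsqrt

/-- **`1 ≤ β` is load-bearing in `stub_stieltjesHalfPlane` (S4 of line `momentum-one-amplitude`).**
With `1 ≤ β` weakened to `0 < β` the stub is false: witness `g s = (s+1)⁻¹`, `β = 1/2`, `M₀ = 1`,
test point `t₀ = 1/16 + i`. [folklore] -/
theorem stub_stieltjesHalfPlane_false_without_one_le :
    ¬ ∀ (g : ℝ → ℝ) (β M₀ : ℝ), IsStieltjesFunction g → 0 < β →
      (∀ r : ℝ, 0 < r → g (r ^ 2) ≤ M₀ * r ^ (-β)) →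
      ∃ F : ℂ → ℂ, DifferentiableOn ℂ F {t : ℂ | 0 < t.re} ∧
        (∀ t : ℝ, 0 < t → F t = ((g (t ^ 2) : ℝ) : ℂ)) ∧
        ∀ t : ℂ, 0 < t.re → ‖F t‖ ≤ M₀ * t.re ^ (-β) := by
  intro h
  have hg : IsStieltjesFunction (fun s : ℝ => (s + 1)⁻¹) :=
    isStieltjesFunction_inv_add_const zero_le_one
  obtain ⟨F, hFd, hFr, hFb⟩ := h (fun s : ℝ => (s + 1)⁻¹) (1 / 2) 1 hg (by norm_num)
    (fun r hr => inv_sq_add_one_le_rpow_neg_half hr)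
  -- the right half-plane and the candidate `G t = (t² + 1)⁻¹`
  set H : Set ℂ := {t : ℂ | 0 < t.re} with hH
  have hHo : IsOpen H := isOpen_lt continuous_const Complex.continuous_re
  have hHc : IsPreconnected H := (convex_halfSpace_re_gt (0 : ℝ)).isPreconnected
  set G : ℂ → ℂ := fun t => (t ^ 2 + 1)⁻¹ with hG
  have hGd : DifferentiableOn ℂ G H := by
    intro t ht
    apply DifferentiableAt.differentiableWithinAt
    have h1 : DifferentiableAt ℂ (fun y : ℂ => y ^ 2 + 1) t :=
      ((differentiableAt_id (𝕜 := ℂ) (x := t)).pow 2).add_const (1 : ℂ)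
    exact h1.inv (sq_add_one_ne_zero_of_re_pos ht)
  -- `F = G` on `H` by the identity theorem (they agree at the real points `t > 0`)
  have hFG : Set.EqOn F G H := by
    refine AnalyticOnNhd.eqOn_of_preconnected_of_frequently_eq (hFd.analyticOnNhd hHo)
      (hGd.analyticOnNhd hHo) hHc (z₀ := (1 : ℂ)) (by simp [hH]) ?_
    have ht : Tendsto (fun w : ℝ => (w : ℂ)) (𝓝[≠] 1) (𝓝[≠] (1 : ℂ)) := by
      refine tendsto_nhdsWithin_of_tendsto_nhds_of_eventually_within _
        ((Complex.continuous_ofReal.tendsto' 1 1 (by simp)).mono_left nhdsWithin_le_nhds) ?_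
      filter_upwards [self_mem_nhdsWithin] with w hw
      simpa using hw
    have hev : ∀ᶠ w : ℝ in 𝓝[≠] 1, F (w : ℂ) = G (w : ℂ) := by
      have hpos : ∀ᶠ w : ℝ in 𝓝[≠] (1 : ℝ), 0 < w :=
        mem_nhdsWithin_of_mem_nhds (Ioi_mem_nhds (by norm_num : (0 : ℝ) < 1))
      filter_upwards [hpos] with w hw
      rw [hFr w hw]
      simp only [hG]
      push_cast
      ring
    exact ht.frequently hev.frequently
  -- evaluate at `t₀ = 1/16 + i`
  set t₀ : ℂ := ((1 / 16 : ℝ) : ℂ) + Complex.I with ht₀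
  have ht₀re : t₀.re = 1 / 16 := by simp [ht₀]
  have ht₀H : t₀ ∈ H := by simp [hH, ht₀re]
  have hval_re : (t₀ ^ 2 + 1).re = 1 / 256 := by
    simp [ht₀, sq, Complex.mul_re]; norm_num
  have hval_im : (t₀ ^ 2 + 1).im = 1 / 8 := by
    simp [ht₀, sq, Complex.mul_im]; norm_num
  have hnorm : ‖t₀ ^ 2 + 1‖ < 1 / 4 := by
    have h2 : ‖t₀ ^ 2 + 1‖ ^ 2 < (1 / 4 : ℝ) ^ 2 := by
      rw [Complex.sq_norm, Complex.normSq_apply, hval_re, hval_im]; norm_num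
    exact lt_of_pow_lt_pow_left₀ 2 (by norm_num) h2
  have hne : t₀ ^ 2 + 1 ≠ 0 := sq_add_one_ne_zero_of_re_pos (by rw [ht₀re]; norm_num)
  have hGt : G t₀ = (t₀ ^ 2 + 1)⁻¹ := rfl
  have hbig : 4 < ‖F t₀‖ := by
    rw [hFG ht₀H, hGt, norm_inv, show (4 : ℝ) = (1 / 4)⁻¹ by norm_num]
    exact inv_strictAnti₀ (norm_pos_iff.2 hne) hnorm
  have hsmall : ‖F t₀‖ ≤ 1 * t₀.re ^ (-(1 / 2 : ℝ)) := hFb t₀ (by rw [ht₀re]; norm_num)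
  have hfour : (1 : ℝ) * (1 / 16 : ℝ) ^ (-(1 / 2 : ℝ)) = 4 := by
    rw [one_mul, Real.rpow_neg (by norm_num), ← Real.sqrt_eq_rpow,
      show (1 / 16 : ℝ) = (1 / 4) ^ 2 by norm_num, Real.sqrt_sq (by norm_num)]
    norm_num
  rw [ht₀re, hfour] at hsmall
  linarith

end Summit.CriticalPhenomena.Ising3DConformalLimit.Theorems.GSMRigidity.Negative
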